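import Summits.Ventures.QEC.Thresholds.PlanarSurfaceCodePhenomSAWBox
import Summits.Ventures.QEC.Thresholds.PlanarPhenomenologicalDepolarizing
import HarnessLib

/-!
# The PLANAR surface codes under PHENOMENOLOGICAL DEPOLARIZING noise at the self-avoiding-walk constant: `p < .0168`,
# `q_X, q_Z < .0112` ⇒ `P_fail → 0` (was `.0151`, `.0101`) — UNCONDITIONAL, kernel

Venture QEC, `Summits/Ventures/QEC/Thresholds/` (LADDER-QEC rung Q5 «toric/surface», PARTITION row 09 "depolarising;
phenomenological"; qec-type-09 gen 7, line D50.L6 «L-PHENOM», planar companion). `PlanarPhenomenologicalDepolarizing.lean` (gen 5,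
item 09.PHDEPOL) certifies the three-rate law (qubits depolarized at rate `p` per round, `X`-check record wrong at `q_X`,
`Z`-check record at `q_Z`; sector-wise minimum-weight space-time decoding) at the cluster-expansion constants
`p ≤ .0151`, `q_X, q_Z ≤ .0101`. Item 135 (C′) certified the planar two-rate BOXES `p', q < p₀(4.7476)` for BOTH records
(`planar_phenom_isThresholdBoxLowerBound_kernelZ3SymmK12`, `…'_kernelZ3SymmK12`, `PlanarSurfaceCodePhenomSAWBox.lean`). Through
lit-2's sandwich `CSSCode.depolPhenom_belowThreshold_iff` (the three-rate failure tends to `0` iff both sector two-rate failures at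
`(2p/3, q_X)`, `(2p/3, q_Z)` do) the boxes give the SAW-constant region:

| theorem | statement |
|---|---|
| `planar_depolPhenom_belowThreshold_of_lt` | `2p/3, q_X, q_Z < p₀(4.7476)`, `p ≤ 1` ⇒ `P_fail → 0` |
| ★ `planar_depolPhenom_belowThreshold_0168_0112` | decimals: **`p < .0168`, `q_X, q_Z < .0112`** ⇒ `P_fail → 0` (`2·(.0168)/3 = .0112 < p₀(4.7476)`) |

All UNCONDITIONAL, tier CERTIFIED (kernel), axioms standard, 0 named facts; certified LOWER bound on the threshold region for
sector-wise (correlation-blind) minimum-weight space-time decoding; the rotated twin is `rsc_depolPhenom_belowThreshold_0168_0112`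
(`RotatedSurfaceCodePhenomSAWBox.lean`, this line). Theorem-only file.

## References

* [DennisEtAl2002] E. Dennis, A. Kitaev, A. Landahl, J. Preskill, J. Math. Phys. 43 (2002) 4452, §4.1 (depolarizing channel; X and
  Z errors corrected separately), §5.3 eq. (threshold_iso_num).
* [AliferisGottesmanPreskill2006] P. Aliferis, D. Gottesman, J. Preskill, arXiv:quant-ph/0504218, §8.2 (chunk p0026 L11: depolarizing).
* [PonitzTittmann2000] Electron. J. Combin. 7 (2000) R21, Table 2 (`d = 3, k = 12`).
-/

noncomputable section

namespace Summit.Ventures.QEC.Thresholds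

open Filter Topology Finset Matrix
open Literature.InformationTheory.QuantumCodes
open Literature.InformationTheory.QuantumCodes.ToricCode (IsPolyBounded)

/-- **Planar surface codes, phenomenological depolarizing noise, sector-wise minimum-weight space-time decoding, at the SAW
constant**: for every polynomially bounded schedule `T`, every pair of minimum-weight space-time decoders (`DZ` on the `X`-check
record `planarHX`, `DX` on the `Z`-check record `planarHZ`) and all rates with `2p/3, q_X, q_Z < p₀(4.7476)`, `p ≤ 1`:
`P_fail → 0`. UNCONDITIONAL. [cite: DennisEtAl2002, §4.1 and §5.3 eq. (threshold_iso_num)] [cite: AliferisGottesmanPreskill2006, §8.2 (chunk p0026 L11)] -/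
theorem planar_depolPhenom_belowThreshold_of_lt {T : ℕ → ℕ} (hT : IsPolyBounded T)
    (DZ : ∀ k, CSSPhenom.STDecoder (PlanarCheck k) (PlanarQubit k) (T k))
    (DX : ∀ k, CSSPhenom.STDecoder (PlanarZCheck k) (PlanarQubit k) (T k))
    (hDZ : ∀ k, (DZ k).IsMinWeight (CSSPhenom.stSyn (planarHX k) (T k)) (CSSPhenom.stCycles (planarHX k) (T k))
      hammingNorm)
    (hDX : ∀ k, (DX k).IsMinWeight (CSSPhenom.stSyn (planarHZ k) (T k)) (CSSPhenom.stCycles (planarHZ k) (T k))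
      hammingNorm)
    {p qX qZ : ℝ} (hp0 : 0 ≤ p) (hp1 : p ≤ 1) (hp : 2 * p / 3 < thresholdValue 4.7476) (hqX0 : 0 ≤ qX)
    (hqX : qX < thresholdValue 4.7476) (hqZ0 : 0 ≤ qZ) (hqZ : qZ < thresholdValue 4.7476) :
    Tendsto (fun k => (PlanarCode.code k).depolPhenomFailureProb (T k) (DZ k) (DX k) p qX qZ) atTop (𝓝 0) := by
  have hq0 : 0 ≤ 2 * p / 3 := by positivity
  have hhalf := thresholdValue_le_half (4.7476 : ℝ)
  have hZ := planar_phenom_isThresholdBoxLowerBound_kernelZ3SymmK12 hT DZ hDZ (2 * p / 3) qX hq0 hqX0 hp hqX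
  have hX := planar_phenom_isThresholdBoxLowerBound'_kernelZ3SymmK12 hT DX hDX (2 * p / 3) qZ hq0 hqZ0 hp hqZ
  exact (CSSCode.depolPhenom_belowThreshold_iff (fun k => PlanarCode.code k) T DZ DX hp0 hp1 hqX0 (by linarith) hqZ0
    (by linarith)).2 ⟨hZ, hX⟩

/-- ★ **Decimal form: `p < .0168`, `q_X, q_Z < .0112` ⇒ `P_fail → 0`** for the planar surface codes under phenomenological
depolarizing noise (sector-wise minimum-weight space-time decoding, poly `T`) — UNCONDITIONAL, kernel; was `.0151`, `.0101`
(`planar_depolPhenom_belowThreshold_0151_0101`). [cite: DennisEtAl2002, §4.1 and §5.3 eq. (threshold_iso_num)] [cite: AliferisGottesmanPreskill2006, §8.2 (chunk p0026 L11)] -/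
theorem planar_depolPhenom_belowThreshold_0168_0112 {T : ℕ → ℕ} (hT : IsPolyBounded T)
    (DZ : ∀ k, CSSPhenom.STDecoder (PlanarCheck k) (PlanarQubit k) (T k))
    (DX : ∀ k, CSSPhenom.STDecoder (PlanarZCheck k) (PlanarQubit k) (T k))
    (hDZ : ∀ k, (DZ k).IsMinWeight (CSSPhenom.stSyn (planarHX k) (T k)) (CSSPhenom.stCycles (planarHX k) (T k))
      hammingNorm)
    (hDX : ∀ k, (DX k).IsMinWeight (CSSPhenom.stSyn (planarHZ k) (T k)) (CSSPhenom.stCycles (planarHZ k) (T k))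
      hammingNorm)
    {p qX qZ : ℝ} (hp0 : 0 ≤ p) (hp : p < 0.0168) (hqX0 : 0 ≤ qX) (hqX : qX < 0.0112) (hqZ0 : 0 ≤ qZ)
    (hqZ : qZ < 0.0112) :
    Tendsto (fun k => (PlanarCode.code k).depolPhenomFailureProb (T k) (DZ k) (DX k) p qX qZ) atTop (𝓝 0) := by
  have h := thresholdValue_47476_bounds.1
  exact planar_depolPhenom_belowThreshold_of_lt hT DZ DX hDZ hDX hp0 (by linarith) (by linarith) hqX0 (by linarith) hqZ0
    (by linarith)

end Summit.Ventures.QEC.Thresholds
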